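import Summits.BirchSwinnertonDyer.BirchSwinnertonDyer.Theses.KatoDescentPotSupersingular
import Summits.BirchSwinnertonDyer.BirchSwinnertonDyer.Theorems.KatoDescentTamePotSupersingularJetchevIrreducibleReadingOfStubs
import HarnessLib

/-!
# Route `KatoDescentPotSupersingular` (rung K9, sub-rung B5 O6 wild 3, cell `bsd-potss`): the K9 face of the SHARED
# crux `JetchevIrreducibleReadingByName` (item 20165) reduced to S1 ∧ S2 ∧ `PublishedInputsHeegner` — by-name twin of
# `KatoDescentTamePotSupersingularJetchevIrreducibleReadingOfStubs` (p502280; seat `bsd-potss-k8t-c4` g8;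
# `--supports 20165`, helper; nothing booked, no item closed, BSD is not proved by any of this)

The crux 20165 is shared by signature between the routes `KatoDescentTamePotSupersingular` (decl
`Theses.KatoDescentTamePotSupersingular.JetchevIrreducibleReadingByName`) and `KatoDescentPotSupersingular` (decl
`Theses.KatoDescentPotSupersingular.JetchevIrreducibleReadingByName`); both unfold to the Literature reading
`Jetchev2008.cor15_irreducibleReading_padicValNat_card_primaryComponent_sha_le`, and both routes hold the same
conjunction `PublishedInputsHeegner` (items 19914). This file states the reduction of p502280 with the K9 decls BY
NAME: the crux follows from (S1) Kolyvagin's structure theorem, upper half, under irreducibility with no reduction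
binder at `p` (McCallum currency; MN19 Thm. 0.7 + §0.11), (S2) the divisibility reading of Jetchev Thm. 1.4 at one
multiplicative carrier `q ∥ N`, `q ≠ p` (irreducible image, additive `p`, `p ∤ c_p`, global Tamagawa binder),
and the held `PublishedInputsHeegner` (Kolyvagin; modularity ⇒ Carayol). S1/S2 are the registered stubs
`stub_structureIrred` / `stub_divisibilityIrredAddv` of the crux's BC3 skeleton. CONDITIONAL on them; closes
NOTHING; BSD is not proved for any curve.

References: [Jetchev2008] Thm. 1.4, Cor. 1.5 (p. 812); [MatarNekovar2019] Thm. 0.7, §0.11 (pp. 456–457);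
[McCallumLMS1991] §5 Lemma 5.1, Cor. 5.6; [GrossLMS1991] §4 (4.1); [Darmon2004] Thm. 3.6–3.7.
-/

set_option autoImplicit false
-- the Theorems directory repeats the summit name (sibling precedent `KatoDescentPotSupersingularAssembly.lean`)
set_option linter.dupNamespace false

noncomputable section

open scoped Classical

namespace Summit.BirchSwinnertonDyer.BirchSwinnertonDyer.Theorems.WildJetchevIrreducibleReadingOfStubs

open WeierstrassCurve Literature.NumberTheory.EllipticCurves
  Literature.NumberTheory.EllipticCurves.ModularForms
  Literature.NumberTheory.EllipticCurves.Rank1Residual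

/-- **The shared crux `JetchevIrreducibleReadingByName`, K9 decl, from S1 + S2 + the K9 route's held conjunction
`PublishedInputsHeegner`** (conjunct 2 = Kolyvagin, conjunct 4 = modularity). By-name twin of
`JetchevIrreducibleReadingOfStubs.jetchevIrreducibleReadingByName_of_structureIrred_of_divisibilityIrred_of_publishedInputsHeegner`
through the route-free core `…cor15_irreducibleReading_of_structureIrred_of_divisibilityIrred_of_kolyvagin_of_newforms`.
CONDITIONAL on `hS`, `hD` (the registered stubs of the crux's skeleton) and `hH`; closes NOTHING.
[cite: Jetchev2008, Cor. 1.5 (p. 812)] [cite: MatarNekovar2019, Thm. 0.7 and §0.11 (pp. 456–457)]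
[cite: McCallumLMS1991, §5 Cor. 5.6 (p. 310)] -/
theorem jetchevIrreducibleReadingByName_of_structureIrred_of_divisibilityIrred_of_publishedInputsHeegner
    (hS : ∀ (W : WeierstrassCurve ℚ) [W.IsElliptic] [W.IsGloballyMinimal] [NeZero (W.conductorNorm ℤ)],
      ¬ W.HasCM →
      ∀ (K : Type) [Field K] [NumberField K], IsImaginaryQuadratic K →
      NumberField.discr K ≠ -3 → NumberField.discr K ≠ -4 →
      SatisfiesHeegnerHypothesis (W.conductorNorm ℤ) K →
      ∀ (p : ℕ) [Fact p.Prime], p ≠ 2 → W.HasIrreducibleModPGaloisRep p →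
      ∀ (Dt : ModularParametrizationData W (W.conductorNorm ℤ)) (β : ℤ) (ι : K →+* ℂ)
        (d₁ : KolyvaginHeegnerData Dt β ι 1) (P : (W.baseChange K).toAffine.Point),
        d₁.toGeomPoints d₁.derivedPoint = toGeomPoints (W.baseChange K) P →
        ¬ IsOfFinAddOrder P →
      ∀ (M₀ : ℕ),
        (∃ Q : (W.baseChange K).toAffine.Point, ((p ^ M₀ : ℕ) : ℤ) • Q = P) →
        (¬ ∃ Q : (W.baseChange K).toAffine.Point, ((p ^ (M₀ + 1) : ℕ) : ℤ) • Q = P) →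
      ∀ (t : ℕ),
        (∀ (s : ℕ), s ≤ t → ∀ (n : ℕ) (d : KolyvaginHeegnerData Dt β ι n), Squarefree n →
          (∀ ℓ ∈ n.primeFactors, Zhang2014.IsKolyvaginPrime (W.conductorNorm ℤ) W K p ℓ ∧
            s ≤ Zhang2014.kolyvaginIndex W p ℓ) →
          ∃ Q : (W.baseChange (ringClassField K ι n)).toAffine.Point,
            ((p ^ s : ℕ) : ℤ) • Q = d.derivedPoint) →
      padicValNat p (Nat.card (AddCommGroup.primaryComponent (W.baseChange K).sha p)) + 2 * t ≤ 2 * M₀)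
    (hD : ∀ (W : WeierstrassCurve ℚ) [W.IsElliptic] [W.IsGloballyMinimal] [NeZero (W.conductorNorm ℤ)],
      ¬ W.HasCM →
      ∀ (K : Type) [Field K] [NumberField K], IsImaginaryQuadratic K →
      NumberField.discr K ≠ -3 → NumberField.discr K ≠ -4 →
      SatisfiesHeegnerHypothesis (W.conductorNorm ℤ) K →
      ∀ (p : ℕ) [Fact p.Prime], p ≠ 2 → Addv W p → 0 ≤ padicValRat p W.j →
      W.HasIrreducibleModPGaloisRep p →
      ¬ p ∣ (W.baseChange ℚ_[p]).localTamagawaNumber ℤ_[p] →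
      (∀ (q' : ℕ) [Fact q'.Prime], q' ∣ W.conductorNorm ℤ →
        p ∣ (W.baseChange ℚ_[q']).localTamagawaNumber ℤ_[q'] → ¬ q' ^ 2 ∣ W.conductorNorm ℤ) →
      ∀ (Dt : ModularParametrizationData W (W.conductorNorm ℤ)) (β : ℤ) (ι : K →+* ℂ)
        (d₁ : KolyvaginHeegnerData Dt β ι 1), ¬ IsOfFinAddOrder d₁.derivedPoint →
      ∀ (q : ℕ) [Fact q.Prime], q ∣ W.conductorNorm ℤ → ¬ q ^ 2 ∣ W.conductorNorm ℤ → q ≠ p →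
      ∀ (s : ℕ), s ≤ padicValNat p ((W.baseChange ℚ_[q]).localTamagawaNumber ℤ_[q]) →
      ∀ (n : ℕ) (d : KolyvaginHeegnerData Dt β ι n), Squarefree n →
        (∀ ℓ ∈ n.primeFactors, Zhang2014.IsKolyvaginPrime (W.conductorNorm ℤ) W K p ℓ ∧
          s ≤ Zhang2014.kolyvaginIndex W p ℓ) →
        ∃ Q : (W.baseChange (ringClassField K ι n)).toAffine.Point,
          ((p ^ s : ℕ) : ℤ) • Q = d.derivedPoint)
    (hH : Theses.KatoDescentPotSupersingular.PublishedInputsHeegner) :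
    Theses.KatoDescentPotSupersingular.JetchevIrreducibleReadingByName := by
  unfold Theses.KatoDescentPotSupersingular.JetchevIrreducibleReadingByName
  exact JetchevIrreducibleReadingOfStubs.cor15_irreducibleReading_of_structureIrred_of_divisibilityIrred_of_kolyvagin_of_newforms
    hS hD hH.2.1 hH.2.2.2.1

end Summit.BirchSwinnertonDyer.BirchSwinnertonDyer.Theorems.WildJetchevIrreducibleReadingOfStubs

end
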